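import Literature.AlgebraicGeometry.FundamentalGroup.RiemannExistenceAffinePoints
import Literature.AlgebraicGeometry.FundamentalGroup.RiemannExistenceFullyFaithfulContinuous
import Literature.AlgebraicGeometry.Motives.AlgPointsProperMapProofs
import Literature.RingTheory.Etale.MilnorPatchingEtale
import Literature.Topology.PatchingHomeomorph
import Literature.Topology.CoveringSpaces.PullbackCovering
import HarnessLib

/-!
# Riemann's existence theorem: finite étale covers descend along a Milnor square

Topic `Literature/AlgebraicGeometry/FundamentalGroup`. The descent step of the reduction of
Riemann's existence theorem in covering form (SGA 1 XII Thm. 5.1, the named fact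
`riemannExistence_finiteCovering`) from a reduced affine base to a NORMAL affine base. SGA 1
performs this reduction by descent of finite étale covers along the (finite, surjective)
normalisation morphism (Exp. IX 4.7); here the same reduction is obtained algebraically from
MILNOR PATCHING (Milnor, *Introduction to algebraic K-theory*, §2): a Milnor square of rings
`A = A₁ ×_{A'} A₂` (`A₁ → A'` onto) glues finite étale algebras
(`Literature.RingTheory.Etale.etale_patchAlgebra`), and on complex points the corresponding
proper two-piece cover `(Spec A₁)(ℂ) ⊔ (Spec A₂)(ℂ) → (Spec A)(ℂ)` glues homeomorphisms
(`Literature.Topology.exists_homeomorph_of_patching`).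

* `ringRiemannExistence_of_milnorSquare` — **Riemann existence in ring form descends along a
  Milnor square** `(A, A₁, A₂, A')` of `ℂ`-algebras with `A` of finite type and `A₁`, `A₂` finite
  over `A`, under the point-set hypotheses «`Spec A₁ ⊔ Spec A₂ → Spec A` onto on `ℂ`-points»,
  «`Spec A₂ → Spec A` injective on `ℂ`-points», «`Spec A₁ → Spec A` injective on `ℂ`-points off
  the image of `Spec A₂`», «`Spec A' → Spec A₁ ×_{Spec A} Spec A₂` onto on `ℂ`-points» (all four
  hold for the conductor square of a finite birational extension and for
  `A/(J₁ ∩ J₂) = A/J₁ ×_{A/(J₁+J₂)} A/J₂`): if every finite-fibred covering of `(Spec Aᵢ)(ℂ)` is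
  `(Spec Bᵢ)(ℂ)` for a finite étale `Aᵢ`-algebra `Bᵢ` (`i = 1, 2`), the same holds for `A`.
  Proof: pull the covering `T → (Spec A)(ℂ)` back to `(Spec Aᵢ)(ℂ)` (`PullbackCovering`),
  algebraise to `Bᵢ`, identify the base changes `A' ⊗ B₁ ≅ A' ⊗ B₂` over `A'` by SGA 1 XII 5.1
  part 1 (`exists_iso_of_homeomorph`, `exists_algEquiv_of_iso`), patch to `B = B₁ ×_θ B₂`
  (finite étale over `A`, `Aᵢ ⊗_A B ≅ Bᵢ`), and patch the homeomorphisms `Bᵢ(ℂ) ≅ T ×_{A(ℂ)} Aᵢ(ℂ)`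
  over the proper cover, the compatibility over common points being the defining equation
  `θ(1 ⊗ b₂) = 1 ⊗ b₁` of the patch read on complex points.
* helpers: `pullbackSwap`, `cornerHomeomorph` (point-set reshufflings of fibre products),
  `specOverOfAlgHom_toAlgHom_comp`, `map_toAlgHom_map_toAlgHom`, `specOverOfAlgHom_tensorInl`,
  `specOverOfAlgHom_tensorInr_comp`, `restrictScalars_comp_tensorInr_comp_patchSndHom`.

Riemann existence "in ring form" for `R` is written out in full in each statement (no named
predicate): every finite-fibred covering `q : T → (Spec R)(ℂ)` admits a finite étale `R`-algebra
`B` and a homeomorphism `(Spec B)(ℂ) ≃ₜ T` over `(Spec R)(ℂ)`. Everything is proved; no named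
facts. Definitions: `pullbackSwap`, `cornerHomeomorph`.

## References

* [SGA1] A. Grothendieck, M. Raynaud, *Revêtements étales et groupe fondamental (SGA 1)*,
  LNM 224 / arXiv:math/0206203, Exp. XII Thm. 5.1, proof, part 2 a) («on peut donc supposer `X`
  normal», via Exp. IX 4.7), p. 333 of the SMF edition (p0184 of the materialised text); Exp. XII
  Thm. 5.1 part 1 (full faithfulness).
* [Milnor1972] J. Milnor, *Introduction to algebraic K-theory*, Annals of Math. Studies 72, §2,
  Thms. 2.1–2.3 (pp. 19–24; p0017–p0020 of `lit read book:milnor1972-introduction-algebraic-k-theory`).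

#harness_tags algebraic_geometry.sga1, hodge.stub_C1
-/

noncomputable section

open CategoryTheory CategoryTheory.Limits AlgebraicGeometry TensorProduct
open _root_.Topology

namespace Literature.AlgebraicGeometry.FundamentalGroup

open Literature.AlgebraicGeometry.Motives Literature.AlgebraicGeometry.Motives.AlgPoints
open Literature.RingTheory.KTheory Literature.RingTheory.Etale

/-! ### Two point-set reshufflings of fibre products -/

section TopHelpers

variable {X X₁ X' Y T : Type*} [TopologicalSpace X] [TopologicalSpace X₁] [TopologicalSpace X']
  [TopologicalSpace Y] [TopologicalSpace T]

/-- `X₁ ×_X Y ≃ₜ Y ×_X X₁` (swap the factors of a fibre product of spaces). [folklore] -/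
def pullbackSwap (f : X₁ → X) (g : Y → X) :
    {p : X₁ × Y // f p.1 = g p.2} ≃ₜ {z : Y × X₁ // g z.1 = f z.2} where
  toFun p := ⟨(p.1.2, p.1.1), p.2.symm⟩
  invFun z := ⟨(z.1.2, z.1.1), z.2.symm⟩
  left_inv _ := rfl
  right_inv _ := rfl
  continuous_toFun := by fun_prop
  continuous_invFun := by fun_prop

/-- `X' ×_{X₁} (X₁ ×_X T) ≃ₜ X' ×_X T` for `j : X' → X₁` over `X`. [folklore] -/
def cornerHomeomorph (j : X' → X₁) (hj : Continuous j) (p₁ : X₁ → X) (q : T → X) (p' : X' → X)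
    (hp' : ∀ x', p₁ (j x') = p' x') :
    {p : X' × {z : X₁ × T // p₁ z.1 = q z.2} // j p.1 = p.2.1.1} ≃ₜ {p : X' × T // p' p.1 = q p.2} where
  toFun p := ⟨(p.1.1, p.1.2.1.2), by rw [← hp', p.2]; exact p.1.2.2⟩
  invFun w := ⟨(w.1.1, ⟨(j w.1.1, w.1.2), by rw [hp']; exact w.2⟩), rfl⟩
  left_inv p := by
    obtain ⟨⟨x', ⟨⟨x₁, t⟩, h⟩⟩, hx⟩ := p
    change j x' = x₁ at hx
    subst hx
    rfl
  right_inv _ := rfl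
  continuous_toFun := by fun_prop
  continuous_invFun := by fun_prop

end TopHelpers

/-! ### Small algebraic-geometric lemmas -/

section AlgHelpers

variable {A A₁ A' : Type} [CommRing A] [Algebra ℂ A] [CommRing A₁] [Algebra ℂ A₁] [CommRing A']
  [Algebra ℂ A'] [Algebra A A₁] [Algebra A₁ A'] [Algebra A A'] [IsScalarTower A A₁ A']
  [IsScalarTower ℂ A A₁] [IsScalarTower ℂ A₁ A'] [IsScalarTower ℂ A A']

variable (A A₁ A') in
/-- `Spec A' → Spec A₁ → Spec A` is the structure map of `A'` over `A`. [folklore] -/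
theorem specOverOfAlgHom_toAlgHom_comp :
    specOverOfAlgHom (IsScalarTower.toAlgHom ℂ A₁ A') ≫ specOverOfAlgHom (IsScalarTower.toAlgHom ℂ A A₁) =
      specOverOfAlgHom (IsScalarTower.toAlgHom ℂ A A') := by
  rw [← specOverOfAlgHom_comp]
  congr 1
  ext a
  simp [IsScalarTower.algebraMap_apply A A₁ A']

variable (A A₁ A') in
/-- Point form of `specOverOfAlgHom_toAlgHom_comp`. [folklore] -/
theorem map_toAlgHom_map_toAlgHom (x : Motives.ComplexPoints (specOver ℂ A')) :
    AlgPoints.map (specOverOfAlgHom (IsScalarTower.toAlgHom ℂ A A₁))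
      (AlgPoints.map (specOverOfAlgHom (IsScalarTower.toAlgHom ℂ A₁ A')) x) =
      AlgPoints.map (specOverOfAlgHom (IsScalarTower.toAlgHom ℂ A A')) x := by
  rw [← AlgPoints.map_comp_apply, specOverOfAlgHom_toAlgHom_comp]

end AlgHelpers

section TensorInl

variable (R A B : Type) [CommRing R] [Algebra ℂ R] [CommRing A] [Algebra ℂ A] [Algebra R A]
  [IsScalarTower ℂ R A] [CommRing B] [Algebra R B]

/-- `a ↦ a ⊗ 1 : A → A ⊗_R B` is the structure map of the `A`-algebra `A ⊗_R B`. [folklore] -/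
theorem specOverOfAlgHom_tensorInl :
    specOverOfAlgHom (tensorInl R A B) =
      specOverOfAlgHom (IsScalarTower.toAlgHom ℂ A (A ⊗[R] B)) := by
  congr 1

/-- `A ⊗_R B ← B ← R` equals `A ⊗_R B ← A ← R` on `Spec`. [folklore] -/
theorem specOverOfAlgHom_tensorInr_comp [Algebra ℂ B] [IsScalarTower ℂ R B] :
    specOverOfAlgHom (tensorInr R A B) ≫ specOverOfAlgHom (IsScalarTower.toAlgHom ℂ R B) =
      specOverOfAlgHom (IsScalarTower.toAlgHom ℂ A (A ⊗[R] B)) ≫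
        specOverOfAlgHom (IsScalarTower.toAlgHom ℂ R A) := by
  rw [← specOverOfAlgHom_comp, ← specOverOfAlgHom_comp]
  congr 1
  ext r
  change Algebra.TensorProduct.includeRight (algebraMap R B r) =
    algebraMap A (A ⊗[R] B) (algebraMap R A r)
  rw [AlgHom.commutes, IsScalarTower.algebraMap_apply R A (A ⊗[R] B)]

end TensorInl

section PatchMaps

variable {A A₁ A₂ A' : Type} [CommRing A] [CommRing A₁] [CommRing A₂] [CommRing A']
  [Algebra ℂ A] [Algebra ℂ A₁] [Algebra ℂ A₂] [Algebra ℂ A']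
  [Algebra A A₁] [Algebra A A₂] [Algebra A₁ A'] [Algebra A₂ A'] [Algebra A A']
  [IsScalarTower A A₁ A'] [IsScalarTower A A₂ A'] [IsScalarTower ℂ A₁ A'] [IsScalarTower ℂ A₂ A']
  {B₁ : Type} [CommRing B₁] [Algebra A₁ B₁] [Algebra A B₁] [IsScalarTower A A₁ B₁] [Algebra ℂ B₁]
  [IsScalarTower ℂ A₁ B₁] [IsScalarTower ℂ A B₁]
  {B₂ : Type} [CommRing B₂] [Algebra A₂ B₂] [Algebra A B₂] [IsScalarTower A A₂ B₂] [Algebra ℂ B₂]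
  [IsScalarTower ℂ A₂ B₂] [IsScalarTower ℂ A B₂]

/-- On the patched algebra `B`, `B → B₂ → A' ⊗ B₂ →θ A' ⊗ B₁` equals `B → B₁ → A' ⊗ B₁` (the
defining equation of the patch), as `ℂ`-algebra maps. [folklore] -/
theorem restrictScalars_comp_tensorInr_comp_patchSndHom
    (θ : (A' ⊗[A₂] B₂) ≃ₐ[A'] (A' ⊗[A₁] B₁)) :
    (θ.toAlgHom.restrictScalars ℂ).comp
        ((tensorInr A₂ A' B₂).comp ((patchSndHom A θ).restrictScalars ℂ)) =
      (tensorInr A₁ A' B₁).comp ((patchFstHom A θ).restrictScalars ℂ) := by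
  ext b
  exact (one_tmul_patchFstHom θ b).symm

end PatchMaps

/-! ### Riemann existence descends along a Milnor square -/

section MilnorDescent

variable {A A₁ A₂ A' : Type} [CommRing A] [CommRing A₁] [CommRing A₂] [CommRing A']
  [Algebra ℂ A] [Algebra ℂ A₁] [Algebra ℂ A₂] [Algebra ℂ A']
  [Algebra A A₁] [Algebra A A₂] [Algebra A₁ A'] [Algebra A₂ A'] [Algebra A A']
  [IsScalarTower A A₁ A'] [IsScalarTower A A₂ A']
  [IsScalarTower ℂ A A₁] [IsScalarTower ℂ A A₂] [IsScalarTower ℂ A₁ A'] [IsScalarTower ℂ A₂ A']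
  [IsScalarTower ℂ A A']

/-- **Riemann existence (ring form) descends along a Milnor square of finite type `ℂ`-algebras.**
Let `A = A₁ ×_{A'} A₂` be a Milnor square (`A₁ → A'` onto) with `A` of finite type over `ℂ` and
`A₁`, `A₂` finite over `A`, such that on complex points `Spec A₁ ⊔ Spec A₂ → Spec A` is onto,
`Spec A₂ → Spec A` is injective, `Spec A₁ → Spec A` is injective outside the image of `Spec A₂`, and
`Spec A' → Spec A₁ ×_{Spec A} Spec A₂` is onto (e.g. the conductor square of a finite birational
extension, or `A/I₁ ∩ I₂ = A/I₁ ×_{A/(I₁+I₂)} A/I₂`). If every finite-fibred covering space of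
`(Spec Aᵢ)(ℂ)` is `(Spec Bᵢ)(ℂ)` for a finite étale `Aᵢ`-algebra `Bᵢ` (`i = 1, 2`), the same holds
for `A`: pull the covering `T → (Spec A)(ℂ)` back to the `(Spec Aᵢ)(ℂ)`, algebraise there, identify
the two base changes to `A'` by the full faithfulness of `Y ↦ Y(ℂ)` on finite étale covers (SGA 1
XII 5.1 part 1, `exists_iso_of_homeomorph`), patch the algebras over the Milnor square (Milnor 1971
§2, `etale_patchAlgebra`) and the homeomorphisms over the proper two-piece cover
(`Literature.Topology.exists_homeomorph_of_patching`). This replaces, for the reduction of SGA 1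
XII 5.1 to a normal base, the descent statement SGA 1 IX 4.7 used in loc. cit.
[cite: SGA1, Exp. XII Thm. 5.1 (proof, part 2 a)); Milnor1972, §2 Thms. 2.1–2.3] -/
theorem ringRiemannExistence_of_milnorSquare [Algebra.FiniteType ℂ A] [Module.Finite A A₁]
    [Module.Finite A A₂] (H : IsMilnorSquare A A₁ A₂ A')
    (hcov : ∀ χ : A →ₐ[ℂ] ℂ, (∃ χ₁ : A₁ →ₐ[ℂ] ℂ, χ₁.comp (IsScalarTower.toAlgHom ℂ A A₁) = χ) ∨
      ∃ χ₂ : A₂ →ₐ[ℂ] ℂ, χ₂.comp (IsScalarTower.toAlgHom ℂ A A₂) = χ)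
    (hinj₂ : ∀ ψ ψ' : A₂ →ₐ[ℂ] ℂ, ψ.comp (IsScalarTower.toAlgHom ℂ A A₂) =
      ψ'.comp (IsScalarTower.toAlgHom ℂ A A₂) → ψ = ψ')
    (hinj₁ : ∀ ψ ψ' : A₁ →ₐ[ℂ] ℂ, ψ.comp (IsScalarTower.toAlgHom ℂ A A₁) =
      ψ'.comp (IsScalarTower.toAlgHom ℂ A A₁) → ψ = ψ' ∨
        ∃ χ₂ : A₂ →ₐ[ℂ] ℂ, χ₂.comp (IsScalarTower.toAlgHom ℂ A A₂) =
          ψ.comp (IsScalarTower.toAlgHom ℂ A A₁))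
    (hcorner : ∀ (ψ₁ : A₁ →ₐ[ℂ] ℂ) (ψ₂ : A₂ →ₐ[ℂ] ℂ),
      ψ₁.comp (IsScalarTower.toAlgHom ℂ A A₁) = ψ₂.comp (IsScalarTower.toAlgHom ℂ A A₂) →
        ∃ ψ' : A' →ₐ[ℂ] ℂ, ψ'.comp (IsScalarTower.toAlgHom ℂ A₁ A') = ψ₁ ∧
          ψ'.comp (IsScalarTower.toAlgHom ℂ A₂ A') = ψ₂)
    (h₁ : ∀ (T : Type) [TopologicalSpace T] (q : T → Motives.ComplexPoints (specOver ℂ A₁)),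
      IsCoveringMap q → (∀ x, (q ⁻¹' {x}).Finite) →
      ∃ (B : Type) (_ : CommRing B) (_ : Algebra A₁ B) (_ : Algebra ℂ B) (_ : IsScalarTower ℂ A₁ B)
        (_ : Module.Finite A₁ B) (_ : Algebra.Etale A₁ B)
        (Φ : Motives.ComplexPoints (specOver ℂ B) ≃ₜ T),
        ∀ z, q (Φ z) = AlgPoints.map (specOverOfAlgHom (IsScalarTower.toAlgHom ℂ A₁ B)) z)
    (h₂ : ∀ (T : Type) [TopologicalSpace T] (q : T → Motives.ComplexPoints (specOver ℂ A₂)),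
      IsCoveringMap q → (∀ x, (q ⁻¹' {x}).Finite) →
      ∃ (B : Type) (_ : CommRing B) (_ : Algebra A₂ B) (_ : Algebra ℂ B) (_ : IsScalarTower ℂ A₂ B)
        (_ : Module.Finite A₂ B) (_ : Algebra.Etale A₂ B)
        (Φ : Motives.ComplexPoints (specOver ℂ B) ≃ₜ T),
        ∀ z, q (Φ z) = AlgPoints.map (specOverOfAlgHom (IsScalarTower.toAlgHom ℂ A₂ B)) z) :
    ∀ (T : Type) [TopologicalSpace T] (q : T → Motives.ComplexPoints (specOver ℂ A)),
      IsCoveringMap q → (∀ x, (q ⁻¹' {x}).Finite) →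
      ∃ (B : Type) (_ : CommRing B) (_ : Algebra A B) (_ : Algebra ℂ B) (_ : IsScalarTower ℂ A B)
        (_ : Module.Finite A B) (_ : Algebra.Etale A B)
        (Φ : Motives.ComplexPoints (specOver ℂ B) ≃ₜ T),
        ∀ z, q (Φ z) = AlgPoints.map (specOverOfAlgHom (IsScalarTower.toAlgHom ℂ A B)) z := by
  intro T _ q hq hfin
  -- the maps on complex points
  let p₁ : Motives.ComplexPoints (specOver ℂ A₁) → Motives.ComplexPoints (specOver ℂ A) :=
    AlgPoints.map (specOverOfAlgHom (IsScalarTower.toAlgHom ℂ A A₁))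
  let p₂ : Motives.ComplexPoints (specOver ℂ A₂) → Motives.ComplexPoints (specOver ℂ A) :=
    AlgPoints.map (specOverOfAlgHom (IsScalarTower.toAlgHom ℂ A A₂))
  have hp₁c : Continuous p₁ := AlgPoints.continuous_map _
  have hp₂c : Continuous p₂ := AlgPoints.continuous_map _
  -- Step 1: algebraise the pulled-back coverings over `A₁` and `A₂`
  obtain ⟨B₁, _, _, _, _, _, _, Φ₁, hΦ₁⟩ := h₁ {p : Motives.ComplexPoints (specOver ℂ A₁) × T // p₁ p.1 = q p.2}
    (fun p ↦ p.1.1) (Literature.Topology.CoveringSpaces.isCoveringMap_pullback_fst p₁ q hp₁c hq)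
    (Literature.Topology.CoveringSpaces.finite_preimage_pullback_fst_singleton p₁ q hfin)
  obtain ⟨B₂, _, _, _, _, _, _, Φ₂, hΦ₂⟩ := h₂ {p : Motives.ComplexPoints (specOver ℂ A₂) × T // p₂ p.1 = q p.2}
    (fun p ↦ p.1.1) (Literature.Topology.CoveringSpaces.isCoveringMap_pullback_fst p₂ q hp₂c hq)
    (Literature.Topology.CoveringSpaces.finite_preimage_pullback_fst_singleton p₂ q hfin)
  change ∀ z, (Φ₁ z).1.1 = _ at hΦ₁
  change ∀ z, (Φ₂ z).1.1 = _ at hΦ₂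
  -- Step 2: `Bᵢ` as `A`-algebras; projectivity
  letI algAB₁ : Algebra A B₁ := ((algebraMap A₁ B₁).comp (algebraMap A A₁)).toAlgebra
  haveI : IsScalarTower A A₁ B₁ := IsScalarTower.of_algebraMap_eq fun _ ↦ rfl
  haveI : IsScalarTower ℂ A B₁ := IsScalarTower.of_algebraMap_eq fun c ↦ by
    change algebraMap ℂ B₁ c = algebraMap A₁ B₁ (algebraMap A A₁ (algebraMap ℂ A c))
    rw [← IsScalarTower.algebraMap_apply ℂ A A₁, ← IsScalarTower.algebraMap_apply ℂ A₁ B₁]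
  letI algAB₂ : Algebra A B₂ := ((algebraMap A₂ B₂).comp (algebraMap A A₂)).toAlgebra
  haveI : IsScalarTower A A₂ B₂ := IsScalarTower.of_algebraMap_eq fun _ ↦ rfl
  haveI : IsScalarTower ℂ A B₂ := IsScalarTower.of_algebraMap_eq fun c ↦ by
    change algebraMap ℂ B₂ c = algebraMap A₂ B₂ (algebraMap A A₂ (algebraMap ℂ A c))
    rw [← IsScalarTower.algebraMap_apply ℂ A A₂, ← IsScalarTower.algebraMap_apply ℂ A₂ B₂]
  haveI := projective_of_etale A₁ B₁
  haveI := projective_of_etale A₂ B₂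
  -- Step 3: the corner `A'` and the two base changes `Bᵢ' = A' ⊗_{Aᵢ} Bᵢ`
  haveI : Algebra.FiniteType ℂ A₁ := Algebra.FiniteType.trans (S := A) inferInstance inferInstance
  haveI : Algebra.FiniteType ℂ A' :=
    (‹Algebra.FiniteType ℂ A₁›).of_surjective (IsScalarTower.toAlgHom ℂ A₁ A') H.surjective
  haveI : IsSeparated (specOver ℂ A').hom := isSeparated_specOver_hom A'
  haveI : LocallyOfFiniteType (specOver ℂ A').hom := locallyOfFiniteType_specOver_hom A'
  let g₁ : specOver ℂ (A' ⊗[A₁] B₁) ⟶ specOver ℂ A' :=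
    specOverOfAlgHom (IsScalarTower.toAlgHom ℂ A' (A' ⊗[A₁] B₁))
  let g₂ : specOver ℂ (A' ⊗[A₂] B₂) ⟶ specOver ℂ A' :=
    specOverOfAlgHom (IsScalarTower.toAlgHom ℂ A' (A' ⊗[A₂] B₂))
  haveI : IsFinite g₁.left := isFinite_left_specOverOfAlgHom_toAlgHom
  haveI : Etale g₁.left := etale_left_specOverOfAlgHom_toAlgHom
  haveI : IsFinite g₂.left := isFinite_left_specOverOfAlgHom_toAlgHom
  haveI : Etale g₂.left := etale_left_specOverOfAlgHom_toAlgHom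
  -- complex points of the corner
  let p' : Motives.ComplexPoints (specOver ℂ A') → Motives.ComplexPoints (specOver ℂ A) :=
    AlgPoints.map (specOverOfAlgHom (IsScalarTower.toAlgHom ℂ A A'))
  let j₁ : Motives.ComplexPoints (specOver ℂ A') → Motives.ComplexPoints (specOver ℂ A₁) :=
    AlgPoints.map (specOverOfAlgHom (IsScalarTower.toAlgHom ℂ A₁ A'))
  let j₂ : Motives.ComplexPoints (specOver ℂ A') → Motives.ComplexPoints (specOver ℂ A₂) :=
    AlgPoints.map (specOverOfAlgHom (IsScalarTower.toAlgHom ℂ A₂ A'))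
  have hj₁ : ∀ x', p₁ (j₁ x') = p' x' := fun x' ↦ map_toAlgHom_map_toAlgHom A A₁ A' x'
  have hj₂ : ∀ x', p₂ (j₂ x') = p' x' := fun x' ↦ map_toAlgHom_map_toAlgHom A A₂ A' x'
  -- `Bᵢ'(ℂ) ≃ₜ T' = A'(ℂ) ×_{A(ℂ)} T` over `A'(ℂ)`
  obtain ⟨Φ₁', hΦ₁'₁, hΦ₁'₂⟩ : ∃ Φ₁' : Motives.ComplexPoints (specOver ℂ (A' ⊗[A₁] B₁)) ≃ₜ
      {p : Motives.ComplexPoints (specOver ℂ A') × T // p' p.1 = q p.2},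
      (∀ y, (Φ₁' y).1.1 = AlgPoints.map g₁ y) ∧
        ∀ y, (Φ₁' y).1.2 = (Φ₁ (AlgPoints.map (specOverOfAlgHom (tensorInr A₁ A' B₁)) y)).1.2 := by
    refine ⟨(tensorPointsHomeomorph A₁ A' B₁).trans
      ((((Homeomorph.refl _).prodCongr Φ₁).subtype (fun x ↦ ?_)).trans
        (cornerHomeomorph j₁ (AlgPoints.continuous_map _) p₁ q p' hj₁)), fun y ↦ ?_, fun y ↦ ?_⟩
    · change _ ↔ j₁ x.1 = (Φ₁ x.2).1.1
      rw [hΦ₁]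
    · change (tensorPointsHomeomorph A₁ A' B₁ y).1.1 = _
      rw [tensorPointsHomeomorph_apply_fst, specOverOfAlgHom_tensorInl]
    · change (Φ₁ (tensorPointsHomeomorph A₁ A' B₁ y).1.2).1.2 = _
      rw [tensorPointsHomeomorph_apply_snd]
  obtain ⟨Φ₂', hΦ₂'₁, hΦ₂'₂⟩ : ∃ Φ₂' : Motives.ComplexPoints (specOver ℂ (A' ⊗[A₂] B₂)) ≃ₜ
      {p : Motives.ComplexPoints (specOver ℂ A') × T // p' p.1 = q p.2},
      (∀ y, (Φ₂' y).1.1 = AlgPoints.map g₂ y) ∧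
        ∀ y, (Φ₂' y).1.2 = (Φ₂ (AlgPoints.map (specOverOfAlgHom (tensorInr A₂ A' B₂)) y)).1.2 := by
    refine ⟨(tensorPointsHomeomorph A₂ A' B₂).trans
      ((((Homeomorph.refl _).prodCongr Φ₂).subtype (fun x ↦ ?_)).trans
        (cornerHomeomorph j₂ (AlgPoints.continuous_map _) p₂ q p' hj₂)), fun y ↦ ?_, fun y ↦ ?_⟩
    · change _ ↔ j₂ x.1 = (Φ₂ x.2).1.1
      rw [hΦ₂]
    · change (tensorPointsHomeomorph A₂ A' B₂ y).1.1 = _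
      rw [tensorPointsHomeomorph_apply_fst, specOverOfAlgHom_tensorInl]
    · change (Φ₂ (tensorPointsHomeomorph A₂ A' B₂ y).1.2).1.2 = _
      rw [tensorPointsHomeomorph_apply_snd]
  -- Step 4: SGA 1 XII 5.1 part 1 over `A'`: the two base changes are isomorphic
  obtain ⟨e, he₁, he₂⟩ := exists_iso_of_homeomorph (X := specOver ℂ A') g₁ g₂ (Φ₁'.trans Φ₂'.symm)
    (fun a ↦ by
      rw [← hΦ₂'₁, Homeomorph.trans_apply, Homeomorph.apply_symm_apply, hΦ₁'₁])
  obtain ⟨θ, hθ⟩ := exists_algEquiv_of_iso (A := A') e he₁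
  have he₃ : ∀ y, Φ₂' (AlgPoints.map e.hom y) = Φ₁' y := fun y ↦ by
    rw [he₂, Homeomorph.trans_apply, Homeomorph.apply_symm_apply]
  -- Step 5: patch the algebras over the Milnor square
  haveI : Module.Finite A (patchAlgebra A θ) := finite_patchAlgebra H θ
  haveI : Algebra.Etale A (patchAlgebra A θ) := etale_patchAlgebra H θ
  have hπ₁ : IsBaseChange A₁ (patchFstHom A θ).toLinearMap := isBaseChange_patchFstHom H θ
  have hπ₂ : IsBaseChange A₂ (patchSndHom A θ).toLinearMap := isBaseChange_patchSndHom H θ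
  let qB : Motives.ComplexPoints (specOver ℂ (patchAlgebra A θ)) → Motives.ComplexPoints (specOver ℂ A) :=
    AlgPoints.map (specOverOfAlgHom (IsScalarTower.toAlgHom ℂ A (patchAlgebra A θ)))
  -- Step 6: the patching data on complex points
  let Ψ₁ : {z : Motives.ComplexPoints (specOver ℂ (patchAlgebra A θ)) ×
      Motives.ComplexPoints (specOver ℂ A₁) // qB z.1 = p₁ z.2} ≃ₜ
      {z : T × Motives.ComplexPoints (specOver ℂ A₁) // q z.1 = p₁ z.2} :=
    (pullbackSwap p₁ qB).symm.trans
      ((((baseChangePointsHomeomorph (patchFstHom A θ) hπ₁).symm.trans Φ₁).trans (pullbackSwap p₁ q)))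
  let Ψ₂ : {z : Motives.ComplexPoints (specOver ℂ (patchAlgebra A θ)) ×
      Motives.ComplexPoints (specOver ℂ A₂) // qB z.1 = p₂ z.2} ≃ₜ
      {z : T × Motives.ComplexPoints (specOver ℂ A₂) // q z.1 = p₂ z.2} :=
    (pullbackSwap p₂ qB).symm.trans
      ((((baseChangePointsHomeomorph (patchSndHom A θ) hπ₂).symm.trans Φ₂).trans (pullbackSwap p₂ q)))
  have hΨ₁ : ∀ z, (Ψ₁ z).1.2 = z.1.2 := fun z ↦ by
    change (Φ₁ ((baseChangePointsHomeomorph (patchFstHom A θ) hπ₁).symm ⟨(z.1.2, z.1.1), _⟩)).1.1 = z.1.2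
    rw [hΦ₁, ← baseChangePointsHomeomorph_apply_fst (patchFstHom A θ) hπ₁,
      Homeomorph.apply_symm_apply]
  have hΨ₂ : ∀ z, (Ψ₂ z).1.2 = z.1.2 := fun z ↦ by
    change (Φ₂ ((baseChangePointsHomeomorph (patchSndHom A θ) hπ₂).symm ⟨(z.1.2, z.1.1), _⟩)).1.1 = z.1.2
    rw [hΦ₂, ← baseChangePointsHomeomorph_apply_fst (patchSndHom A θ) hπ₂,
      Homeomorph.apply_symm_apply]
  -- Step 7: the hypotheses on complex points
  haveI : IsFinite (specOverOfAlgHom (IsScalarTower.toAlgHom ℂ A A₁)).left :=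
    isFinite_left_specOverOfAlgHom_toAlgHom
  haveI : IsFinite (specOverOfAlgHom (IsScalarTower.toAlgHom ℂ A A₂)).left :=
    isFinite_left_specOverOfAlgHom_toAlgHom
  have hp₁ : IsProperMap p₁ := AlgPoints.isProperMap_map _
  have hp₂ : IsProperMap p₂ := AlgPoints.isProperMap_map _
  have hcovP : ∀ x, (∃ x₁, p₁ x₁ = x) ∨ ∃ x₂, p₂ x₂ = x := fun x ↦ by
    obtain ⟨χ, rfl⟩ := exists_specOverOfAlgHom_eq x
    rcases hcov χ with ⟨χ₁, h⟩ | ⟨χ₂, h⟩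
    · refine Or.inl ⟨specOverOfAlgHom χ₁, ?_⟩
      change AlgPoints.map _ _ = _
      rw [map_specOverOfAlgHom, h]
    · refine Or.inr ⟨specOverOfAlgHom χ₂, ?_⟩
      change AlgPoints.map _ _ = _
      rw [map_specOverOfAlgHom, h]
  have hinj₂P : Function.Injective p₂ := fun x x' h ↦ by
    obtain ⟨ψ, rfl⟩ := exists_specOverOfAlgHom_eq x
    obtain ⟨ψ', rfl⟩ := exists_specOverOfAlgHom_eq x'
    change AlgPoints.map _ _ = AlgPoints.map _ _ at h
    rw [map_specOverOfAlgHom, map_specOverOfAlgHom] at h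
    rw [hinj₂ ψ ψ' (specOverOfAlgHom_injective h)]
  have hinj₁P : ∀ x₁ x₁', p₁ x₁ = p₁ x₁' → x₁ = x₁' ∨ ∃ x₂, p₂ x₂ = p₁ x₁ := fun x₁ x₁' h ↦ by
    obtain ⟨ψ, rfl⟩ := exists_specOverOfAlgHom_eq x₁
    obtain ⟨ψ', rfl⟩ := exists_specOverOfAlgHom_eq x₁'
    change AlgPoints.map _ _ = AlgPoints.map _ _ at h
    rw [map_specOverOfAlgHom, map_specOverOfAlgHom] at h
    rcases hinj₁ ψ ψ' (specOverOfAlgHom_injective h) with h' | ⟨χ₂, h'⟩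
    · exact Or.inl (by rw [h'])
    · refine Or.inr ⟨specOverOfAlgHom χ₂, ?_⟩
      change AlgPoints.map _ _ = AlgPoints.map _ _
      rw [map_specOverOfAlgHom, map_specOverOfAlgHom, h']
  have hcornerP : ∀ x₁ x₂, p₁ x₁ = p₂ x₂ → ∃ x', j₁ x' = x₁ ∧ j₂ x' = x₂ := fun x₁ x₂ h ↦ by
    obtain ⟨ψ₁, rfl⟩ := exists_specOverOfAlgHom_eq x₁
    obtain ⟨ψ₂, rfl⟩ := exists_specOverOfAlgHom_eq x₂
    change AlgPoints.map _ _ = AlgPoints.map _ _ at h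
    rw [map_specOverOfAlgHom, map_specOverOfAlgHom] at h
    obtain ⟨ψ', h1, h2⟩ := hcorner ψ₁ ψ₂ (specOverOfAlgHom_injective h)
    refine ⟨specOverOfAlgHom ψ', ?_, ?_⟩
    · change AlgPoints.map _ _ = _
      rw [map_specOverOfAlgHom, h1]
    · change AlgPoints.map _ _ = _
      rw [map_specOverOfAlgHom, h2]
  -- Step 8: compatibility of `Ψ₁`, `Ψ₂` over common points of `Spec B`
  have hc : ∀ (z₁ : {z : Motives.ComplexPoints (specOver ℂ (patchAlgebra A θ)) ×
      Motives.ComplexPoints (specOver ℂ A₁) // qB z.1 = p₁ z.2})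
      (z₂ : {z : Motives.ComplexPoints (specOver ℂ (patchAlgebra A θ)) ×
        Motives.ComplexPoints (specOver ℂ A₂) // qB z.1 = p₂ z.2}),
      z₁.1.1 = z₂.1.1 → (Ψ₁ z₁).1.1 = (Ψ₂ z₂).1.1 := by
    rintro ⟨⟨y, x₁⟩, hx₁⟩ ⟨⟨y', x₂⟩, hx₂⟩ hyy
    change y = y' at hyy
    subst hyy
    change qB y = p₁ x₁ at hx₁
    change qB y = p₂ x₂ at hx₂
    -- the points `yᵢ ∈ (Spec Bᵢ)(ℂ)` over `(xᵢ, y)`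
    set y₁ := (baseChangePointsHomeomorph (patchFstHom A θ) hπ₁).symm ⟨(x₁, y), hx₁.symm⟩
      with hy₁def
    set y₂ := (baseChangePointsHomeomorph (patchSndHom A θ) hπ₂).symm ⟨(x₂, y), hx₂.symm⟩
      with hy₂def
    change (Φ₁ y₁).1.2 = (Φ₂ y₂).1.2
    have hy₁a : AlgPoints.map (specOverOfAlgHom (IsScalarTower.toAlgHom ℂ A₁ B₁)) y₁ = x₁ := by
      rw [← baseChangePointsHomeomorph_apply_fst (patchFstHom A θ) hπ₁ y₁, hy₁def,
        Homeomorph.apply_symm_apply]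
    have hy₁b : AlgPoints.map (specOverOfAlgHom ((patchFstHom A θ).restrictScalars ℂ)) y₁ = y := by
      rw [← baseChangePointsHomeomorph_apply_snd (patchFstHom A θ) hπ₁ y₁, hy₁def,
        Homeomorph.apply_symm_apply]
    have hy₂a : AlgPoints.map (specOverOfAlgHom (IsScalarTower.toAlgHom ℂ A₂ B₂)) y₂ = x₂ := by
      rw [← baseChangePointsHomeomorph_apply_fst (patchSndHom A θ) hπ₂ y₂, hy₂def,
        Homeomorph.apply_symm_apply]
    have hy₂b : AlgPoints.map (specOverOfAlgHom ((patchSndHom A θ).restrictScalars ℂ)) y₂ = y := by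
      rw [← baseChangePointsHomeomorph_apply_snd (patchSndHom A θ) hπ₂ y₂, hy₂def,
        Homeomorph.apply_symm_apply]
    -- a point `x' ∈ (Spec A')(ℂ)` over `(x₁, x₂)` and a point `y₁' ∈ (Spec B₁')(ℂ)` over `(x', y₁)`
    obtain ⟨x', hx'₁, hx'₂⟩ := hcornerP x₁ x₂ (hx₁.symm.trans hx₂)
    obtain ⟨y₁', hy₁'a, hy₁'b⟩ := exists_tensorPoint A₁ A' B₁ x' y₁ (by
      change j₁ x' = _
      rw [hx'₁, hy₁a])
    have k₁ : (Φ₁' y₁').1.2 = (Φ₁ y₁).1.2 := by rw [hΦ₁'₂, hy₁'b]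
    have k₂ : (Φ₁' y₁').1.1 = x' := by
      rw [hΦ₁'₁]
      change AlgPoints.map (specOverOfAlgHom (IsScalarTower.toAlgHom ℂ A' (A' ⊗[A₁] B₁))) y₁' = x'
      rw [← specOverOfAlgHom_tensorInl, hy₁'a]
    -- transport along `e : Spec B₁' ≅ Spec B₂'`
    have k₃ : (Φ₂ (AlgPoints.map (specOverOfAlgHom (tensorInr A₂ A' B₂))
        (AlgPoints.map e.hom y₁'))).1.2 = (Φ₁ y₁).1.2 := by
      rw [← hΦ₂'₂, he₃, k₁]
    have k₄ : AlgPoints.map g₂ (AlgPoints.map e.hom y₁') = x' := by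
      rw [← hΦ₂'₁, he₃, k₂]
    -- the image of `e(y₁')` in `(Spec B₂)(ℂ)` is `y₂`
    suffices hyy₂ : AlgPoints.map (specOverOfAlgHom (tensorInr A₂ A' B₂)) (AlgPoints.map e.hom y₁') = y₂ by
      rw [← k₃, hyy₂]
    apply baseChangePoints_ext (patchSndHom A θ) hπ₂
    · rw [hy₂a, ← AlgPoints.map_comp_apply, specOverOfAlgHom_tensorInr_comp, AlgPoints.map_comp_apply]
      change j₂ (AlgPoints.map g₂ (AlgPoints.map e.hom y₁')) = x₂
      rw [k₄, hx'₂]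
    · rw [hy₂b, ← AlgPoints.map_comp_apply, ← AlgPoints.map_comp_apply, ← hθ,
        ← specOverOfAlgHom_comp, ← specOverOfAlgHom_comp,
        restrictScalars_comp_tensorInr_comp_patchSndHom, specOverOfAlgHom_comp,
        AlgPoints.map_comp_apply, hy₁'b, hy₁b]
  -- Step 9: patch the homeomorphisms
  obtain ⟨Ψ, hΨ, -, -⟩ := Literature.Topology.exists_homeomorph_of_patching qB q p₁ p₂
    (AlgPoints.continuous_map _) hq.continuous hp₁ hp₂ hcovP hinj₂P hinj₁P Ψ₁ hΨ₁ Ψ₂ hΨ₂ hc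
  exact ⟨patchAlgebra A θ, inferInstance, inferInstance, inferInstance, inferInstance,
    inferInstance, inferInstance, Ψ, hΨ⟩

end MilnorDescent


end Literature.AlgebraicGeometry.FundamentalGroup

end
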